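import Summits.BirchSwinnertonDyer.BirchSwinnertonDyer.Theorems.ResidualThetaTransportAtTwoResidualSignedLambdaLowerCMAtTwoLocalBlockCountAway
import Summits.BirchSwinnertonDyer.BirchSwinnertonDyer.Theorems.ResidualThetaTransportAtTwoResidualSignedLambdaLowerCMAtTwoOfParts
import Literature.NumberTheory.EllipticCurves.GreenbergVatsal2000.GreenbergSelmerGroups
import HarnessLib

/-!
# S1⊕ `stub_localDualAwayTwo` of line `onepair` — PROVED (registered split stub of crux RSL_g `ResidualSignedLambdaLowerCMAtTwo`,
# stmt-BirchSwinnertonDyer-22608, skeleton v3a sha16 5e6e1bb525182a96, record siglen 3 085)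

Route `ResidualThetaTransportAtTwo` (RTT); width seat `prover-bsd-wall-tp2-p2x-w3` g16 (S1⊕ lane by name, LEAD rtt-p2 g18 bus 2026-08-29T05:46:27Z).
THEOREMS ONLY (no definition, no named fact, no instance, no notation, no `sorry`); `--supports` the crux (stub credit); closes nothing by itself —
BSD is not proved by any of this and RSL_g stays OPEN (stubs `stub_katoZetaCMAtTwo` PRINT-HOLD, EH, S4₂, S4₀ and the glue `stub_onePairSupply` remain).

`stub_localDualAwayTwo` (the registered signature VERBATIM = LEAD desk `text_S1.sig`): under the habitat-lite binders of RSL_g, the pins `π : OnePairPins …`,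
binder `ℤ₂`-structures on the local blocks `Dloc (Set.range ι) κ ρ w` (`w ∈ S₀`) and the S₀-side pin bundle `πₐ : AwayPins … π`:
**`Module.Finite ℚ_[2] (ℚ₂ ⊗_{ℤ₂} PAway (Set.range ι) κ ρ S₀) ∧ π.f * (∑ v ∈ S₀, 2 ^ nfl v * (if ℓ_v ∣ M then 0 else if ‖embCoeff g ι ℓ_v‖ < 1 then 2 else 0))
≤ lamTwo 2 (PAway (Set.range ι) κ ρ S₀)`** — Greenberg–Vatsal's Prop. 2.4 count of `P_{S₀} = Π_{w ∈ S₀} Π_{c ∈ C_w} (H¹(ℚ_{∞,w̃_c}, A_ρ))^∨` at `p = 2`.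
Proof = `ThetaTransport.LocalBlockCount.finite_and_sum_le_lamTwo_PAway` (file `…LocalBlockCountAway.lean`, the body assembled from the local-block chain:
abstract GV corank form · cofree block · RSL_g Frobenius currency · carrier of record · Σ/Π bookkeeping · ramified FIN via UTD's tame-inertia structure)
with `S := Set.range ι`, `a := embCoeff g ι`, `B := π.B`, after the two finite-dimensionality instances of the coefficient fields
(`IsNewform0.finiteDimensional_coeffField_holds`, `GreenbergSelmer.finiteDimensional_padicCoeffField`). Used binders: `κ.IsCyclotomic`, `∀ v ∈ S₀, 2 ∉ v`,
the habitat clause `hρ`, `IsNewform0 g`, `Irreducible ϖ`, `π.B`; the pin bundle `πₐ`, `I`, `Sg`, `Θ` and the curve hypotheses are not used (S1⊕ is `ρ`-intrinsic).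

References: [GreenbergVatsal2000] §1 p. 7, §2 Prop. (2.4) and proof (arXiv p. 22), p. 17; [Kato2004Asterisque] §13.8 (p. 228); [Washington1997] §13.1;
[SerreLocalFields1979] Ch. XIII §1 Prop. 1; [Greenberg2006] §3 A (proof of Prop. 3.2).
-/

set_option autoImplicit false
-- the Theorems namespace of this sub repeats the summit name by design (D-0017 nested layout)
set_option linter.dupNamespace false

noncomputable section

open scoped Classical

namespace Summit.BirchSwinnertonDyer.BirchSwinnertonDyer.Theorems.OnePair

open Literature.NumberTheory.EllipticCurves Literature.NumberTheory.EllipticCurves.GreenbergSelmer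
open Literature.NumberTheory.GaloisRepresentations NumberField IsDedekindDomain Field
open Literature.NumberTheory.EllipticCurves GreenbergSelmer Kobayashi2003 Literature.NumberTheory.GaloisRepresentations
  IsDedekindDomain NumberField Field Rat.HeightOneSpectrum PowerSeries

/-- **S1⊕ `stub_localDualAwayTwo` — FIN of `ℚ₂ ⊗ P_{S₀}` and the Greenberg–Vatsal COUNT `π.f · Σ_{v ∈ S₀} 2^{n_v}·(0 | 2 | 0) ≤ λ_{ℤ₂}(P_{S₀})`**
(registered split stub of skeleton `onepair` v3a, text verbatim). From `ThetaTransport.LocalBlockCount.finite_and_sum_le_lamTwo_PAway`.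
[cite: GreenbergVatsal2000, §2 Prop. (2.4) and proof (arXiv p. 22)] [cite: Kato2004Asterisque, §13.8 (p. 228)] [cite: Washington1997, §13.1] -/
theorem stub_localDualAwayTwo :
    open Literature.NumberTheory.EllipticCurves GreenbergSelmer GreenbergVatsal2000 Kobayashi2003 ModularForms Rank1Residual Literature.NumberTheory.GaloisRepresentations Literature.NumberTheory.Automorphic IsDedekindDomain NumberField Field Rat.HeightOneSpectrum PowerSeries Summit.BirchSwinnertonDyer.BirchSwinnertonDyer.Theorems.OnePair in ∀ (W : WeierstrassCurve ℚ) [W.IsElliptic] [W.IsGloballyMinimal], GoodSS W 2 → W.frobeniusTrace 2 = 0 → W.Δ < 0 → ∀ (M : ℕ) [NeZero M] (g : CuspForm (CongruenceSubgroup.Gamma0 M) 2) (ι : coeffField g →+* PadicAlgCl 2), Odd M → IsNewform0 g → IsCMForm (liftToGamma1 M 2 g) → cuspCoeff g 2 = 0 → (∀ ℓ : ℕ, ℓ.Prime → ¬ ℓ ∣ 2 * M * W.conductorNorm ℤ → ‖embCoeff g ι ℓ - (W.frobeniusTrace ℓ : PadicAlgCl 2)‖ < 1) → ∀ (κ : ZpExtension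 ℚ 2) (γ : absoluteGaloisGroup ℚ), κ.IsCyclotomic → κ.IsTopGenerator γ → IsCyclotomicVariable 2 γ → ∀ (S₀ : Finset (HeightOneSpectrum (RingOfIntegers ℚ))), (∀ v ∈ S₀, ((2 : ℕ) : RingOfIntegers ℚ) ∉ v.asIdeal) → (∀ v, ¬ W.HasGoodReductionAt v → v ∈ S₀) → (∀ v, natGenerator v ∣ M → v ∈ S₀) → ∀ (n : ℕ) (ρ : FramedGaloisRep ℚ (coeffO (Set.range ι)) 2) (Θ : ∀ v : HeightOneSpectrum (RingOfIntegers ℚ), ((2 : ℕ) : RingOfIntegers ℚ) ∈ v.asIdeal → (CofreeF (Set.range ι) ρ ≃+ (Fin n → ↥(W.geomPrimaryTorsion 2)))), (∀ v, ¬ natGenerator v ∣ 2 * M → ρ.IsUnramifiedAt v ∧ ∃ P : Polynomial (coeffO (Set.range ι)), P.map (padicCoeffIntegers (Set.range ι)).subtype = Polynomial.X ^ 2 - Polynomial.C (embCoeff g ι (natGenerator v)) * Polynomial.X + Polynomial.C ((natGenerator v : ℕ) : PadicAlgCl 2) ∧ ρ.HasFrobCharpolyAt v P) → ∀ (hΘ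 : ∀ v hv (δ : absoluteGaloisGroup (v.adicCompletion ℚ)) m i, Θ v hv (resGalOfEmb (closureEmb (K := ℚ) (v.adicCompletion ℚ)) δ • m) i = resGalOfEmb (closureEmb (K := ℚ) (v.adicCompletion ℚ)) δ • Θ v hv m i), ∀ (ϖ : (coeffO (Set.range ι))), Irreducible ϖ → ∀ (Sg : AddSubgroup (H1Γ (Set.range ι) κ ρ)) [Module (coeffO (Set.range ι)) ↥Sg], (∀ (a : (coeffO (Set.range ι))) (s : ↥Sg), ((a • s : ↥Sg) : H1Γ (Set.range ι) κ ρ) = scalarH1 κ.kerSubgroup (CofreeF (Set.range ι) ρ) a s) → (∀ y : H1Γ (Set.range ι) κ ρ, y ∈ Sg ↔ y ∈ plusSelmerSet (Set.range ι) W κ S₀ n ρ Θ) → (∀ (τ : absoluteGaloisGroup ℚ) (y : H1Γ (Set.range ι) κ ρ), y ∈ Sg → conjH1 κ.kerSubgroup (CofreeF (Set.range ι) ρ) τ y ∈ Sg) → (plusSelmerTorsionSet (Set.range ι) W κ S₀ n ρ Θ ϖ).Finite → ∀ (I : Kato2004.IwasawaH1DataCoeff (FramedGaloisRep.toGaloisRep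 ρ) 2 κ γ) [Module (coeffO (Set.range ι)) I.H] [IsScalarTower (coeffO (Set.range ι)) (IwasawaAlgebraO (Set.range ι)) I.H], (∀ (a : (coeffO (Set.range ι))) (x : I.H), a • x = (PowerSeries.C a : IwasawaAlgebraO (Set.range ι)) • x) → ∀ (π : OnePairPins (Set.range ι) W κ γ S₀ n ρ Θ hΘ I Sg), ∀ [∀ w : ↥S₀, Module ℤ_[2] (Dloc (Set.range ι) κ ρ (w : HeightOneSpectrum (RingOfIntegers ℚ)))] (πₐ : AwayPins (Set.range ι) κ ρ S₀ W γ n Θ hΘ I Sg π), Module.Finite ℚ_[2] (TensorProduct ℤ_[2] ℚ_[2] (PAway (Set.range ι) κ ρ S₀)) ∧ π.f * (∑ v ∈ S₀, 2 ^ nfl v * (if natGenerator v ∣ M then 0 else (if ‖embCoeff g ι (natGenerator v)‖ < 1 then 2 else 0))) ≤ lamTwo 2 (PAway (Set.range ι) κ ρ S₀) := by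
  intro W _ _ _ _ _ M _ g ι _ hnew _ _ _ κ γ hκ _ _ S₀ hS₀2 _ _ n ρ Θ hρ hΘ ϖ hϖ Sg _ _ _ _ _ I _ _ _ π _ πₐ
  haveI : FiniteDimensional ℚ (ModularForms.coeffField g) := ModularForms.IsNewform0.finiteDimensional_coeffField_holds hnew
  haveI : FiniteDimensional ℚ_[2] (padicCoeffField (Set.range ι)) := GreenbergSelmer.finiteDimensional_padicCoeffField ι
  exact ThetaTransport.LocalBlockCount.finite_and_sum_le_lamTwo_PAway (Set.range ι) κ ρ S₀ hκ hS₀2 M (embCoeff g ι) hρ hϖ π.B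

end Summit.BirchSwinnertonDyer.BirchSwinnertonDyer.Theorems.OnePair

end
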